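import Literature.MathematicalPhysics.QuantumFieldTheory.YangMillsOS
import HarnessLib

/-!
# Regular variation of the fixed-torus Wilson partition function at zero temperature (named fact)

For a compact group `G` with a faithful continuous unitary matrix representation `r` (so that `G`,
hence `G^E`, is a compact real-analytic manifold and the Wilson action
`S(U) = ∑ₚ (N − Re tr r(U_p))` is a real-analytic — indeed polynomial — function of the link
variables) and any finite torus `(ℤ/L)^4`, the partition function
`Z_L(β) = ∫_{G^E} e^{−β S(U)} ∏ₑ dU_e` is a **Laplace integral with analytic phase** whose minimum
value is `0` (attained on the flat configurations). By the asymptotic theory of such integrals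
(resolution of singularities of the phase: Atiyah 1970, Bernstein–Gelfand 1969, Malgrange 1974;
Arnold–Gusein-Zade–Varchenko, Vol. II, Theorem 7.6 with §7.3; Watanabe 2009, Theorem 7.1(1) for the
global form over a compact parameter set with a non-negative analytic phase and positive smooth
amplitude), as `β → +∞`

  `Z_L(β) · β^λ / (log β)^m → C`   for some `C > 0`, a rational `λ > 0` and `m ∈ ℕ`

(`λ` = the real log-canonical threshold of the flat variety, `m + 1` its multiplicity). In particular
`Z_L` is regularly varying at infinity with index `−λ`.

This file records that consequence as a NAMED FACT (`WilsonPartitionRegularVariation`); nothing is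
proved in THIS file. The fact is DISCHARGED downstream: the theorem
`WilsonPartitionRegularVariation_holds : WilsonPartitionRegularVariation` of
`Literature/MathematicalPhysics/QuantumFieldTheory/WilsonPartitionRegularVariationHolds.lean` (which
imports this file through the proved layers `…RegularVariationProofs` → `…LaplaceForm` →
`…ResolutionForm` → `…HironakaForm` → `…LocalResolution` → `…TubeForm` of this directory) proves
it by an algebraic rendering of the printed argument: the compact linear group `ρ(G)^E` is real
algebraic (Chevalley) with smooth algebraic local models whose real points form a real-analytic
manifold, the Wilson action is a regular function on it, Kollár's log resolution
(`Literature.AlgebraicGeometry.Resolution.exists_logResolution_of_isClosed`) supplies the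
simultaneous resolution of the phase and of the tube boundary with monomial normal forms and
monomial Jacobian at real points, and the power-log Laplace asymptotics of monomial phases plus the
Abelian comparison give the limit. Users holding a hypothesis
`(h : WilsonPartitionRegularVariation)` should feed it `WilsonPartitionRegularVariation_holds`.
The fact is consumed by the fixed-torus doubling bound
`Z_L(β/2) ≤ e^{O(L⁴)} Z_L(β)` of the line `generic-step-gamma-encoding` of crux
`FemtoCurvatureTwoPoint` (route `LangevinControlUV` of `YangMills`), where together with a crude
Gaussian lower bound `Z_L(β) ≥ e^{−cL⁴} β^{−2DL⁴}` it yields `λ ≤ 2 D L⁴` and the doubling.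

## References

* V. I. Arnold, S. M. Gusein-Zade, A. N. Varchenko, *Singularities of Differentiable Maps, Vol. II*,
  Birkhäuser (2012 reprint), Part II, §7.3, Theorem 7.6 (asymptotics of the Laplace integral) with
  Theorem 7.5 §§1, 2, 4 [ArnoldGuseinzadeVarchenko2012].
* S. Watanabe, *Algebraic Geometry and Statistical Learning Theory*, CUP (2009), Theorem 7.1(1)
  (`lim (log n)^{m−1} n^{λ} ∫ e^{−nK(w)} φ(w) dw = c₁ > 0`), Definition 6.1 and Theorem 6.? for the
  fundamental conditions [WatanabeSumio2009].
-/

noncomputable section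

open MeasureTheory Filter Topology

namespace Literature.MathematicalPhysics.QuantumFieldTheory

/-- **Regular variation of the fixed-torus Wilson partition function** (consequence of the
asymptotic expansion of Laplace integrals with analytic phase — Arnold–Gusein-Zade–Varchenko II,
Theorem 7.6 with Theorem 7.5 §§1, 2, 4; Watanabe 2009, Theorem 7.1(1) — applied to the polynomial
phase `S = wilsonAction r.ρ ≥ 0` on the compact real-analytic manifold `G^E` with the Haar amplitude,
via finitely many exponential charts and a partition of unity). For every compact `G` with a
faithful continuous unitary representation `r`, every torus side `L ≥ 1`: there are `C > 0`,
`λ ≥ 0` and `m ∈ ℕ` with `Z_L(β) · β^λ / (log β)^m → C` as `β → ∞`, where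
`Z_L(β) = partitionFunction r.ρ β` on `(ℤ/L)^4`.
-- TODO(general form): the sources give the full asymptotic series `Σ_{α,k} a_{k,α} β^{−α} (log β)^k`
-- for `∫ e^{−βf} φ` with `f` analytic near its minimum set and `φ` smooth of compact support, with
-- `α` in finitely many arithmetic progressions of positive rationals and a non-zero leading
-- coefficient for `φ ≥ 0`, `φ > 0` at the minimum; only the leading-term consequence for the Wilson
-- action on a compact linear group is recorded, the tree having no real-analytic manifolds.
[cite: ArnoldGuseinzadeVarchenko2012, Part II §7.3 Theorem 7.6] [cite: WatanabeSumio2009, Theorem 7.1(1)] -/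
def WilsonPartitionRegularVariation : Prop :=
  ∀ (G : Type) [Group G] [TopologicalSpace G] [IsTopologicalGroup G] [CompactSpace G]
      [MeasurableSpace G] [BorelSpace G] (r : LatticeRep G) (L : ℕ) [NeZero L],
    ∃ (C lam : ℝ) (m : ℕ), 0 < C ∧ 0 ≤ lam ∧
      Tendsto (fun β : ℝ =>
        (partitionFunction (d := 4) (L := L) r.ρ β).toReal * β ^ lam / Real.log β ^ m)
        atTop (nhds C)

end Literature.MathematicalPhysics.QuantumFieldTheory

end
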